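import Literature.MathematicalPhysics.KineticTheory.CollisionTubeVarianceStaticsGeneral
import Literature.MathematicalPhysics.KineticTheory.CollisionTubeMeanRung0SpeedCutoffMark
import HarnessLib

/-!
# The collision-tube functional at rung 0 for a GENERAL bounded mark with a speed cutoff: the static
# variance bound, modulo the decorated pair-pair decorrelation of the canonical hard-sphere measure

Topic `Literature/MathematicalPhysics/KineticTheory` (kind proof; mark-generic twin of
`CollisionTubeVarianceRung0.variance_tubeStat_rung0_le`, wanted by the crux line `Sketch` of
`InformationPercolationEngine.CollisionRate`, stmt-AtomisticToContinuum-13481, registered stub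
`stub_fixedTimeVarianceUnitRung0`, whose mark is the speed-truncated UNIT mark `Ξ₁ᴸ(n, v, w) = ψ_L(‖w − v‖)`).
Constant profiles `(a, u, θ)`, `N + 1` spheres of diameter `ε = ε_N` on `𝕋³`, rung-0 law
`G_N = zipConfig_# (P_N ⊗ ⊗ᵢ N(u, θ))` (`HardSphereUniformGas`; `P_N = posGibbsMeasure 1 ε (N+1)`), and the
collision-tube functional at truncation level `1`, `A_t = tubeStat σ N χ g Ξ r r 1 κ t`, for a measurable mark
`|Ξ| ≤ C` vanishing at relative speed `‖v − v'‖ ≥ 2L` — NO vanishing at grazing normals is assumed (the sibling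
file is hard-wired to the truncated even marks `Ξ_L^{kl}`, which vanish there).  The one new point is that the
double-sum form `A_t = ((N+1)κ)⁻¹ Σ_{i≠j} χ(t, xᵢ) g(σ³ρ̃_r(x, xᵢ)) M_{ij}` (`M_{ij} = pairTubeMark ε κ Ξ i j x v`)
holds only ALMOST SURELY under `G_N` (`tubeStat_one_ae_eq_sum_tubeMark`: grazing pairs are `G_N`-null), which is
all the variance sees (`variance_congr`); the bookkeeping is then that of `variance_tubeStat_rung0_le` verbatim,
with the generic decorated-sum variance `variance_prod_decoratedTubeSum_le_of_bound` (`2L ↦ C`):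

  `Var_{G_N}(A_t) ≤ K₁/(N+1) + K₂ ζ + K₃ ζ'² + K₄ P_N(Bad_N(δ, r))`

(`variance_tubeStat_rung0_le_of_speedCutoff`), constants depending only on `(C, L, κ, C_χ, C_g, σ)`, GIVEN the
decorated pair-pair decorrelation of `P_N` for indicators at level `ζ` (hypothesis `hdec`, weight `χ(t, ·)/C_χ`)
and a continuity modulus `ζ'` of `g` at `σ³` on the `δ`-neighbourhood of `1` (hypothesis `hmod`).

References: C. Cercignani, R. Illner, M. Pulvirenti (1994) §2.2 [CIPDiluteGases1994]; D. Ruelle (1969)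
§4.2 [Ruelle1969]; H. Spohn (1991) Part I §2.3 [Spohn1991].
-/

noncomputable section

namespace Literature.MathematicalPhysics.KineticTheory

open MeasureTheory ProbabilityTheory Set Filter Function
open scoped ENNReal InnerProductSpace BigOperators
open Literature.Analysis.FluidPDE Literature.Probability.Moments

/-! ## The static variance bound for a general mark -/

/-- **The static tube variance at rung 0 for a GENERAL mark, modulo the decorated pair-pair decorrelation.**
Small reduced density, constant profiles `a, θ > 0`, `u`, `N ≥ 1`, continuous `χ` with `|χ(t, ·)| ≤ C_χ`
(`C_χ > 0`), continuous `g` with `|g| ≤ C_g` on `[0, ∞)` and modulus `|g(σ³y) − g(σ³)| ≤ ζ'` for `y ≥ 0`,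
`|y − 1| < δ`, a measurable mark `|Ξ| ≤ C` (`C > 0`) vanishing at relative speed `≥ 2L` (`L ≥ 0`), `κ > 0`,
`r > 0`, `ε(1 + 2Lκ) < 1/2`, and the decorated pair-pair decorrelation bound of `P_N` for indicators at level
`ζ ≥ 0` with weight `χ(t, ·)/C_χ`.  Then, with `C_p = (3 + 4Lκ)³`, `V_L = (4π/3)(1 + 2Lκ)³`,
`Var_{G_N}(A_t) ≤ 2 (C_g C_χ/κ)² ((16 C² C_p² + 32 C² V_L σ³ + 192 C² V_L² σ⁶)/(N+1) + 8 ζ C² V_L² σ⁶)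
  + 2 (C C_χ C_p/κ)² (2 ζ'² + 8 C_g² P_N(Bad_N(δ, r)))`.
Proof: that of `variance_tubeStat_rung0_le`, run on the almost-sure double-sum form
`tubeStat_one_ae_eq_sum_tubeMark` (`variance_congr`) and on `variance_prod_decoratedTubeSum_le_of_bound`. [folklore] -/
theorem variance_tubeStat_rung0_le_of_speedCutoff {σ : ℝ} (hsd : SmallDensity uniformProfile σ) {a θ : ℝ}
    (ha : 0 < a) (hθ : 0 < θ) (u : V3) {N : ℕ} (hN : 1 ≤ N)
    (Φ : HardSphereFlow (Torus.geometry (Fin 3)) (hsDiameter σ N) (N + 1))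
    {χ : ℝ × UnitAddTorus (Fin 3) → ℝ} (hχ : Continuous χ) {Cχ : ℝ} (hCχ : 0 < Cχ) (t : ℝ)
    (hχb : ∀ y, |χ (t, y)| ≤ Cχ) {g : ℝ → ℝ} (hg : Continuous g) {Cg : ℝ} (hCg : ∀ y, 0 ≤ y → |g y| ≤ Cg)
    {Ξ : V3 × V3 × V3 → ℝ} (hΞm : Measurable Ξ) {C L κ r : ℝ} (hCpos : 0 < C) (hC : ∀ p, |Ξ p| ≤ C)
    (hL : 0 ≤ L) (hΞL : ∀ m v v' : V3, 2 * L ≤ ‖v - v'‖ → Ξ (m, v, v') = 0) (hκ : 0 < κ) (hr : 0 < r)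
    (hεL : hsDiameter σ N * (1 + 2 * L * κ) < 1 / 2) {ζ : ℝ} (hζ : 0 ≤ ζ)
    (hdec : ∀ i j i' j' : Fin (N + 1), i ≠ j → i ≠ i' → i ≠ j' → j ≠ i' → j ≠ j' → i' ≠ j' →
      ∀ T T' : Set T3, MeasurableSet T → MeasurableSet T' →
      |(∫ x, χ (t, x i) / Cχ * T.indicator (fun _ => (1 : ℝ)) (x j - x i) *
          (χ (t, x i') / Cχ * T'.indicator (fun _ => (1 : ℝ)) (x j' - x i'))
          ∂posGibbsMeasure (fun _ : T3 => (1 : ℝ)) (hsDiameter σ N) (N + 1)) -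
        (∫ x, χ (t, x i) / Cχ * T.indicator (fun _ => (1 : ℝ)) (x j - x i)
          ∂posGibbsMeasure (fun _ : T3 => (1 : ℝ)) (hsDiameter σ N) (N + 1)) *
        (∫ x, χ (t, x i') / Cχ * T'.indicator (fun _ => (1 : ℝ)) (x j' - x i')
          ∂posGibbsMeasure (fun _ : T3 => (1 : ℝ)) (hsDiameter σ N) (N + 1))|
        ≤ ζ * (volume T).toReal * (volume T').toReal)
    {ζ' δ : ℝ} (hζ' : 0 ≤ ζ') (hδ : 0 < δ)
    (hmod : ∀ y, 0 ≤ y → |y - 1| < δ → |g (σ ^ 3 * y) - g (σ ^ 3)| ≤ ζ') :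
    variance (fun z => tubeStat σ N χ g Ξ r r 1 κ t z)
        (localGibbsLaw σ (fun _ => a) (fun _ => u) (fun _ => θ) N Φ) ≤
      2 * (Cg * Cχ / κ) ^ 2 *
          ((16 * C ^ 2 * ((3 + 4 * L * κ) ^ 3) ^ 2 + 32 * C ^ 2 * (4 / 3 * Real.pi * (1 + 2 * L * κ) ^ 3) * σ ^ 3 +
              192 * C ^ 2 * (4 / 3 * Real.pi * (1 + 2 * L * κ) ^ 3) ^ 2 * σ ^ 6) / (N + 1 : ℕ) +
            8 * ζ * C ^ 2 * (4 / 3 * Real.pi * (1 + 2 * L * κ) ^ 3) ^ 2 * σ ^ 6) +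
        2 * (C * Cχ * (3 + 4 * L * κ) ^ 3 / κ) ^ 2 * (2 * ζ' ^ 2 + 8 * Cg ^ 2 *
          (posGibbsMeasure (fun _ : T3 => (1 : ℝ)) (hsDiameter σ N) (N + 1)).real (sqDevEvent (N + 1) δ r)) := by
  have hσ := hsd.σ_pos
  have hε := hsDiameter_pos hσ N
  haveI := isProbabilityMeasure_posGibbsMeasure continuous_const (fun _ => one_pos) hsd.σ_lt_half.le N
  set P := posGibbsMeasure (fun _ : T3 => (1 : ℝ)) (hsDiameter σ N) (N + 1) with hP
  set Q : Measure (Fin (N + 1) → V3) := Measure.pi fun _ : Fin (N + 1) => gaussMeasure u θ with hQ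
  set Cp : ℝ := (3 + 4 * L * κ) ^ 3 with hCp
  set n : ℝ := ((N + 1 : ℕ) : ℝ) with hn
  have hn0 : 0 < n := by rw [hn]; positivity
  have hn' : (N + 1 : ℝ) = n := by rw [hn]; push_cast; ring
  set c₀ : ℝ := (n * κ)⁻¹ with hc₀
  have hc₀0 : 0 ≤ c₀ := by positivity
  have hC0 : 0 ≤ C := hCpos.le
  -- the weight `h = χ(t, ·)/C_χ`
  set h : T3 → ℝ := fun y => χ (t, y) / Cχ with hh
  have hhm : Measurable h := (hχ.comp (Continuous.prodMk_right t)).measurable.div_const _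
  have hh1 : ∀ y, |h y| ≤ 1 := fun y => by
    rw [hh]; dsimp only; rw [abs_div, abs_of_pos hCχ, div_le_one hCχ]; exact hχb y
  -- the almost-sure double-sum form of the tube functional on phase space
  set Asum : Config (N + 1) (Fin 3) T3 → ℝ := fun z => c₀ * ∑ i, ∑ j,
      (if i ≠ j then χ (t, (z i).1) * g (σ ^ 3 * empDensity r (fun m => (z m).1) (z i).1) *
        tubeMark κ Ξ ((hsDiameter σ N)⁻¹ • Torus.reprSym ((z i).1 - (z j).1)) (z i).2 (z j).2 else 0) with hAsum
  have hae0 : (fun z => tubeStat σ N χ g Ξ r r 1 κ t z) =ᵐ[localGibbsLaw σ (fun _ => a) (fun _ => u) (fun _ => θ) N Φ]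
      Asum := by
    filter_upwards [tubeStat_one_ae_eq_sum_tubeMark (u := u) Φ hsd hN ha hθ χ g Ξ r r κ] with z hz
    rw [hz t, hAsum, hc₀, ← hn']
  -- the three functions on the product space
  set A' : (Fin (N + 1) → T3) × (Fin (N + 1) → V3) → ℝ := fun p => Asum (zipConfig p) with hA'
  set S : (Fin (N + 1) → T3) × (Fin (N + 1) → V3) → ℝ := fun p =>
    ∑ i, ∑ j, if i ≠ j then h (p.1 i) * pairTubeMark (hsDiameter σ N) κ Ξ i j p.1 p.2 else 0 with hS
  set c₁ : ℝ := c₀ * g (σ ^ 3) * Cχ with hc₁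
  set R : (Fin (N + 1) → T3) × (Fin (N + 1) → V3) → ℝ := fun p => A' p - c₁ * S p with hR
  set M : (Fin (N + 1) → T3) × (Fin (N + 1) → V3) → Fin (N + 1) → Fin (N + 1) → ℝ :=
    fun p i j => pairTubeMark (hsDiameter σ N) κ Ξ i j p.1 p.2 with hM
  -- formulas
  have hA'eq : ∀ p, A' p = c₀ * ∑ i, ∑ j,
      (if i ≠ j then χ (t, p.1 i) * g (σ ^ 3 * empDensity r p.1 (p.1 i)) * M p i j else 0) := fun p => by
    rw [hA', hAsum, hM]
    simp only [zipConfig_apply, pairTubeMark]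
  have hSeq : ∀ p, c₁ * S p = c₀ * ∑ i, ∑ j, (if i ≠ j then χ (t, p.1 i) * g (σ ^ 3) * M p i j else 0) := fun p => by
    rw [hS, hc₁]
    dsimp only
    rw [Finset.mul_sum, Finset.mul_sum]
    refine Finset.sum_congr rfl fun i _ => ?_
    rw [Finset.mul_sum, Finset.mul_sum]
    refine Finset.sum_congr rfl fun j _ => ?_
    split_ifs
    · rw [hh]; dsimp only; field_simp; try ring
    · rw [mul_zero, mul_zero]
  have hReq : ∀ p, R p = c₀ * ∑ i, ∑ j,
      (if i ≠ j then χ (t, p.1 i) * (g (σ ^ 3 * empDensity r p.1 (p.1 i)) - g (σ ^ 3)) * M p i j else 0) := by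
    intro p
    rw [hR]; dsimp only
    rw [hA'eq p, hSeq p, ← mul_sub, ← Finset.sum_sub_distrib]
    congr 1
    refine Finset.sum_congr rfl fun i _ => ?_
    rw [← Finset.sum_sub_distrib]
    refine Finset.sum_congr rfl fun j _ => ?_
    split_ifs <;> ring
  -- measurability
  have hterm_m : ∀ i j, Measurable fun p : (Fin (N + 1) → T3) × (Fin (N + 1) → V3) =>
      (if i ≠ j then χ (t, p.1 i) * g (σ ^ 3 * empDensity r p.1 (p.1 i)) * M p i j else 0) := by
    intro i j
    by_cases hij : i ≠ j
    · simp only [if_pos hij, hM]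
      have h0 : Measurable fun x : Fin (N + 1) → T3 => (x, x i) := measurable_id.prodMk (measurable_pi_apply i)
      have h1 := (measurable_empDensity r).comp h0
      have h2 : Measurable fun p : (Fin (N + 1) → T3) × (Fin (N + 1) → V3) =>
          g (σ ^ 3 * empDensity r p.1 (p.1 i)) := hg.measurable.comp ((h1.comp measurable_fst).const_mul _)
      have h3 : Measurable fun p : (Fin (N + 1) → T3) × (Fin (N + 1) → V3) => χ (t, p.1 i) :=
        (hχ.comp (Continuous.prodMk_right t)).measurable.comp ((measurable_pi_apply i).comp measurable_fst)
      exact (h3.mul h2).mul (measurable_pairTubeMark (hsDiameter σ N) κ hΞm i j)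
    · simp only [if_neg hij]; exact measurable_const
  have hA'm : Measurable A' := by
    rw [show A' = fun p => c₀ * ∑ i, ∑ j,
      (if i ≠ j then χ (t, p.1 i) * g (σ ^ 3 * empDensity r p.1 (p.1 i)) * M p i j else 0) from funext hA'eq]
    exact (Finset.measurable_sum _ fun i _ => Finset.measurable_sum _ fun j _ => hterm_m i j).const_mul _
  have hSm : Measurable S := measurable_decoratedTubeSum (hsDiameter σ N) κ hΞm hhm
  -- boundedness and `L²`
  have hMb : ∀ p i j, |M p i j| ≤ C := fun p i j => abs_pairTubeMark_le _ κ hC i j _ _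
  have hCg0 : 0 ≤ Cg := (abs_nonneg _).trans (hCg 0 le_rfl)
  have hρ0 : ∀ (x : Fin (N + 1) → T3) y, 0 ≤ empDensity r x y := fun x y => (empDensity_mem_Icc hr x y).1
  have hsum2 : ∀ {f : Fin (N + 1) → Fin (N + 1) → ℝ} {C' : ℝ}, (∀ i j, |f i j| ≤ C') →
      |∑ i, ∑ j, f i j| ≤ n * (n * C') := fun {f C'} hf => by
    refine (Finset.abs_sum_le_sum_abs _ _).trans ?_
    calc ∑ i, |∑ j, f i j| ≤ ∑ _i : Fin (N + 1), (n * C') := Finset.sum_le_sum fun i _ =>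
          (Finset.abs_sum_le_sum_abs _ _).trans ((Finset.sum_le_sum fun j _ => hf i j).trans (by
            rw [Finset.sum_const, Finset.card_univ, Fintype.card_fin, nsmul_eq_mul]))
      _ = n * (n * C') := by rw [Finset.sum_const, Finset.card_univ, Fintype.card_fin, nsmul_eq_mul]
  have hA'b : ∀ p, |A' p| ≤ c₀ * (n * (n * (Cχ * Cg * C))) := fun p => by
    rw [hA'eq p, abs_mul, abs_of_nonneg hc₀0]
    refine mul_le_mul_of_nonneg_left (hsum2 fun i j => ?_) hc₀0
    split_ifs
    · rw [abs_mul, abs_mul]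
      exact mul_le_mul (mul_le_mul (hχb _) (hCg _ (mul_nonneg (by positivity) (hρ0 _ _))) (abs_nonneg _)
        hCχ.le) (hMb p i j) (abs_nonneg _) (mul_nonneg hCχ.le hCg0)
    · rw [abs_zero]; positivity
  have hSb : ∀ p, |S p| ≤ n * (n * C) := fun p => hsum2 fun i j => by
    split_ifs
    · rw [abs_mul]; exact (mul_le_mul (hh1 _) (hMb p i j) (abs_nonneg _) zero_le_one).trans_eq (one_mul _)
    · rw [abs_zero]; exact hC0
  have hA'2 : MemLp A' 2 (P.prod Q) := memLp_two_of_abs_le' hA'm hA'b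
  have hS2 : MemLp (fun p => c₁ * S p) 2 (P.prod Q) := (memLp_two_of_abs_le' hSm hSb).const_mul c₁
  have hR2 : MemLp R 2 (P.prod Q) := hA'2.sub hS2
  have hRm : Measurable R := hA'm.sub (hSm.const_mul c₁)
  -- (1) the split `Var A' ≤ 2 c₁² Var S + 2 Var R`
  have hsplit : variance A' (P.prod Q) ≤ 2 * (c₁ ^ 2 * variance S (P.prod Q)) + 2 * variance R (P.prod Q) := by
    have e : A' = fun p => c₁ * S p + R p := by funext p; rw [hR]; ring
    rw [e, ← variance_const_mul]
    exact variance_add_le_two_mul hS2 hR2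
  -- (2) the decorated tube sum
  have hVarS := variance_prod_decoratedTubeSum_le_of_bound hsd hN hΞm hCpos hC hL hκ.le hΞL hεL hhm hh1
    (gaussMeasure u θ) hζ hdec
  -- (3) the density-weight remainder
  set Bad : Set (Fin (N + 1) → T3) := sqDevEvent (N + 1) δ r with hBad
  have hBadm : MeasurableSet Bad := measurableSet_sqDevEvent (N + 1) δ r
  set Dx : (Fin (N + 1) → T3) → ℝ := fun x => ζ' + 2 * Cg * Bad.indicator (fun _ => (1 : ℝ)) x with hDx
  have hDle : ∀ (x : Fin (N + 1) → T3) i, |g (σ ^ 3 * empDensity r x (x i)) - g (σ ^ 3)| ≤ Dx x := by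
    intro x i
    by_cases hx : x ∈ Bad
    · rw [hDx]; dsimp only; rw [indicator_of_mem hx, mul_one]
      calc |g (σ ^ 3 * empDensity r x (x i)) - g (σ ^ 3)| ≤ |g (σ ^ 3 * empDensity r x (x i))| + |g (σ ^ 3)| :=
            abs_sub _ _
        _ ≤ Cg + Cg := add_le_add (hCg _ (mul_nonneg (by positivity) (hρ0 _ _))) (hCg _ (by positivity))
        _ ≤ ζ' + 2 * Cg := by linarith
    · rw [hDx]; dsimp only; rw [indicator_of_notMem hx, mul_zero, add_zero]
      exact hmod _ (hρ0 _ _) (abs_empDensity_sub_one_lt_of_not_mem hδ hr hx (x i))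
  have hDx0 : ∀ x, 0 ≤ Dx x := fun x => add_nonneg hζ' (mul_nonneg (mul_nonneg zero_le_two hCg0)
    (indicator_nonneg (fun _ _ => zero_le_one) _))
  have hDx2 : ∀ x, Dx x ^ 2 ≤ 2 * ζ' ^ 2 + 8 * Cg ^ 2 * Bad.indicator (fun _ => (1 : ℝ)) x := fun x => by
    by_cases hx : x ∈ Bad
    · rw [hDx]; dsimp only; rw [indicator_of_mem hx, mul_one, mul_one]
      linarith [sq_nonneg (ζ' - 2 * Cg), show (ζ' + 2 * Cg) ^ 2 = 2 * ζ' ^ 2 + 8 * Cg ^ 2 - (ζ' - 2 * Cg) ^ 2 by ring]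
    · rw [hDx]; dsimp only; rw [indicator_of_notMem hx, mul_zero, add_zero, mul_zero, add_zero]
      linarith [sq_nonneg ζ']
  -- the shell sum on the hard core
  have hMsum : ∀ p : (Fin (N + 1) → T3) × (Fin (N + 1) → V3), p.1 ∈ posDomain (hsDiameter σ N) (N + 1) →
      ∑ i, ∑ j, |M p i j| ≤ n * (C * Cp) := by
    intro p hp
    calc ∑ i, ∑ j, |M p i j| ≤ ∑ i, C * shellCount σ N L κ (zipConfig p) i := by
          refine Finset.sum_le_sum fun i _ => ?_
          calc ∑ j, |M p i j| ≤ ∑ j, C * shellInd σ N L κ (zipConfig p) i j :=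
                Finset.sum_le_sum fun j _ => abs_tubeMark_le_mul_shellInd hε hC hκ.le hΞL (zipConfig p) i j
            _ = C * shellCount σ N L κ (zipConfig p) i := by rw [shellCount, Finset.mul_sum]
      _ ≤ ∑ _i : Fin (N + 1), C * Cp := Finset.sum_le_sum fun i _ =>
          mul_le_mul_of_nonneg_left (shellCount_zipConfig_le_cube hε (mul_nonneg hL hκ.le) hp p.2 i) hC0
      _ = n * (C * Cp) := by rw [Finset.sum_const, Finset.card_univ, Fintype.card_fin, nsmul_eq_mul]
  have hRpt : ∀ p : (Fin (N + 1) → T3) × (Fin (N + 1) → V3), p.1 ∈ posDomain (hsDiameter σ N) (N + 1) →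
      |R p| ≤ C * Cχ * Cp / κ * Dx p.1 := by
    intro p hp
    rw [hReq p, abs_mul, abs_of_nonneg hc₀0]
    have hterm : ∀ i j, |(if i ≠ j then χ (t, p.1 i) * (g (σ ^ 3 * empDensity r p.1 (p.1 i)) - g (σ ^ 3)) * M p i j
        else 0)| ≤ Cχ * Dx p.1 * |M p i j| := fun i j => by
      split_ifs
      · rw [abs_mul, abs_mul]
        exact mul_le_mul_of_nonneg_right (mul_le_mul (hχb _) (hDle p.1 i) (abs_nonneg _) hCχ.le) (abs_nonneg _)
      · rw [abs_zero]; exact mul_nonneg (mul_nonneg hCχ.le (hDx0 _)) (abs_nonneg _)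
    calc c₀ * |∑ i, ∑ j, (if i ≠ j then χ (t, p.1 i) * (g (σ ^ 3 * empDensity r p.1 (p.1 i)) - g (σ ^ 3)) * M p i j
          else 0)| ≤ c₀ * ∑ i, ∑ j, Cχ * Dx p.1 * |M p i j| := by
          refine mul_le_mul_of_nonneg_left ((Finset.abs_sum_le_sum_abs _ _).trans (Finset.sum_le_sum fun i _ =>
            (Finset.abs_sum_le_sum_abs _ _).trans (Finset.sum_le_sum fun j _ => hterm i j))) hc₀0
      _ = c₀ * (Cχ * Dx p.1 * ∑ i, ∑ j, |M p i j|) := by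
          congr 1; rw [Finset.mul_sum]; exact Finset.sum_congr rfl fun i _ => by rw [Finset.mul_sum]
      _ ≤ c₀ * (Cχ * Dx p.1 * (n * (C * Cp))) :=
          mul_le_mul_of_nonneg_left (mul_le_mul_of_nonneg_left (hMsum p hp) (mul_nonneg hCχ.le (hDx0 _))) hc₀0
      _ = C * Cχ * Cp / κ * Dx p.1 := by rw [hc₀]; field_simp
  have hae : ∀ᵐ p ∂(P.prod Q), p.1 ∈ posDomain (hsDiameter σ N) (N + 1) := by
    rw [ae_iff]
    have hsub : {p : (Fin (N + 1) → T3) × (Fin (N + 1) → V3) | ¬p.1 ∈ posDomain (hsDiameter σ N) (N + 1)} ⊆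
        (posDomain (hsDiameter σ N) (N + 1))ᶜ ×ˢ (univ : Set (Fin (N + 1) → V3)) := fun p hp => ⟨hp, mem_univ _⟩
    refine measure_mono_null hsub ?_
    rw [Measure.prod_prod, posGibbsMeasure_compl_posDomain, zero_mul]
  have hVarR : variance R (P.prod Q) ≤ (C * Cχ * Cp / κ) ^ 2 * (2 * ζ' ^ 2 + 8 * Cg ^ 2 * P.real Bad) := by
    have hbd : ∀ᵐ p ∂(P.prod Q), R p ^ 2 ≤
        (C * Cχ * Cp / κ) ^ 2 * (2 * ζ' ^ 2 + 8 * Cg ^ 2 * Bad.indicator (fun _ => (1 : ℝ)) p.1) := by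
      filter_upwards [hae] with p hp
      calc R p ^ 2 ≤ (C * Cχ * Cp / κ * Dx p.1) ^ 2 := by
            rw [← sq_abs (R p)]; exact pow_le_pow_left₀ (abs_nonneg _) (hRpt p hp) 2
        _ = (C * Cχ * Cp / κ) ^ 2 * Dx p.1 ^ 2 := by ring
        _ ≤ _ := mul_le_mul_of_nonneg_left (hDx2 p.1) (sq_nonneg _)
    have hint : Integrable (fun p : (Fin (N + 1) → T3) × (Fin (N + 1) → V3) =>
        (C * Cχ * Cp / κ) ^ 2 * (2 * ζ' ^ 2 + 8 * Cg ^ 2 * Bad.indicator (fun _ => (1 : ℝ)) p.1)) (P.prod Q) :=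
      (((integrable_const _).add ((((integrable_const (1 : ℝ)).indicator hBadm).comp_fst Q).const_mul _)).const_mul _)
    calc variance R (P.prod Q) ≤ ∫ p, (R ^ 2) p ∂(P.prod Q) := variance_le_expectation_sq hRm.aestronglyMeasurable
      _ ≤ ∫ p, (C * Cχ * Cp / κ) ^ 2 * (2 * ζ' ^ 2 + 8 * Cg ^ 2 * Bad.indicator (fun _ => (1 : ℝ)) p.1) ∂(P.prod Q) :=
          integral_mono_of_nonneg (ae_of_all _ fun p => by simp only [Pi.pow_apply]; exact sq_nonneg _) hint
            (hbd.mono fun p hp => by simpa only [Pi.pow_apply] using hp)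
      _ = (C * Cχ * Cp / κ) ^ 2 * (2 * ζ' ^ 2 + 8 * Cg ^ 2 * P.real Bad) := by
          rw [integral_const_mul, integral_fun_fst (fun x => 2 * ζ' ^ 2 + 8 * Cg ^ 2 * Bad.indicator (fun _ => (1 : ℝ)) x),
            probReal_univ, one_smul, integral_add (integrable_const _) (((integrable_const (1 : ℝ)).indicator hBadm).const_mul _),
            integral_const, probReal_univ, one_smul, integral_const_mul, integral_indicator_const _ hBadm, smul_eq_mul, mul_one]
  -- (4) the transfer and the arithmetic
  rw [variance_congr hae0, variance_localGibbsLaw_rung0_eq σ ha hθ u N Φ (A := Asum) hA'm]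
  change variance A' (P.prod Q) ≤ _
  have hc₁ : c₁ ^ 2 ≤ (Cg * Cχ / κ) ^ 2 / n ^ 2 := by
    have h1 : |c₁| ≤ Cg * Cχ / (n * κ) := by
      rw [hc₁, abs_mul, abs_mul, abs_of_nonneg hc₀0, abs_of_pos hCχ, hc₀]
      calc (n * κ)⁻¹ * |g (σ ^ 3)| * Cχ ≤ (n * κ)⁻¹ * Cg * Cχ :=
            mul_le_mul_of_nonneg_right (mul_le_mul_of_nonneg_left (hCg _ (by positivity)) (by positivity)) hCχ.le
        _ = Cg * Cχ / (n * κ) := by field_simp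
    calc c₁ ^ 2 = |c₁| ^ 2 := (sq_abs _).symm
      _ ≤ (Cg * Cχ / (n * κ)) ^ 2 := pow_le_pow_left₀ (abs_nonneg _) h1 2
      _ = (Cg * Cχ / κ) ^ 2 / n ^ 2 := by field_simp
  have hVS0 := variance_nonneg S (P.prod Q)
  have he3 : n * (hsDiameter σ N) ^ 3 = σ ^ 3 := by rw [hn]; exact succ_mul_hsDiameter_pow_three σ N
  have hkey : c₁ ^ 2 * variance S (P.prod Q) ≤ (Cg * Cχ / κ) ^ 2 *
      ((16 * C ^ 2 * Cp ^ 2 + 32 * C ^ 2 * (4 / 3 * Real.pi * (1 + 2 * L * κ) ^ 3) * σ ^ 3 +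
          192 * C ^ 2 * (4 / 3 * Real.pi * (1 + 2 * L * κ) ^ 3) ^ 2 * σ ^ 6) / n +
        8 * ζ * C ^ 2 * (4 / 3 * Real.pi * (1 + 2 * L * κ) ^ 3) ^ 2 * σ ^ 6) := by
    refine (mul_le_mul hc₁ hVarS hVS0 (by positivity)).trans (le_of_eq ?_)
    rw [show σ ^ 6 = (σ ^ 3) ^ 2 by ring, ← he3, hCp]
    field_simp
    ring
  have hfin := hsplit.trans (add_le_add (mul_le_mul_of_nonneg_left hkey zero_le_two)
    (mul_le_mul_of_nonneg_left hVarR zero_le_two))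
  rw [hn] at hfin
  exact hfin.trans (le_of_eq (by ring))

end Literature.MathematicalPhysics.KineticTheory

end
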